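import Literature.NumberTheory.EllipticCurves.GreenbergSelmerNewform
import Mathlib.LinearAlgebra.Quotient.Basic
import HarnessLib

/-!
# Coordinates on the cofree module `A = F²/𝒪²` of a framed rank-two representation: in a frame `Q₀ ∈ GL₂(𝒪)` the action of
# `g` on `A ≅ (F/𝒪) × (F/𝒪)` is the matrix `Q₀⁻¹ ρ(g) Q₀` acting on coordinates (proofs only)

Topic `NumberTheory/EllipticCurves` (namespace `Literature.NumberTheory.EllipticCurves.GreenbergSelmer`). THEOREMS ONLY (no
definition, no named fact, no instance; D-0026). For a framed representation `ρ : G → GL₂(𝒪)` and its cofree module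
`A = Cofree ρ F = F²/𝒪²` (Greenberg 1989 p. 98 "`A_p = V_p/T_p`"; EPW §3.1 "`A_f = K/𝒪 ⊗ T_f`"), every integral change of frame
`Q₀ ∈ GL₂(𝒪)` yields an `𝒪`-linear isomorphism `Φ : A ≃ (F/𝒪) × (F/𝒪)` (coordinates of `Q₀⁻¹ v` modulo `𝒪`) under which
`g ∈ G` acts by the matrix `T = Q₀⁻¹ ρ(g) Q₀`: `Φ(g·a) = (T₀₀ y₀ + T₀₁ y₁, T₁₀ y₀ + T₁₁ y₁)` for `Φ(a) = (y₀, y₁)`. With an ORDINARY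
frame (`T₁₀ = 0` on a decomposition group: EPW (eq:ordes), Wiles 1988 Thm 2.2 — the tree's named fact
`Hida2000_thm326_ordinary_unitRoot` after `exists_integralFrame_of_frame`) this is the TRIANGULAR MODEL consumed by
`Summits/…/Theorems/ErratumRoadFiveFixedPartTriangularReduction.lean` (cell `bsd-stepL`, crux 25505, stub (FIX)).

* `exists_cofree_coordinates` — the isomorphism `Φ` and the action formula (any `Q₀`, any `g`);
* `finite_setOf_smul_quotient_eq_zero` — `(F/𝒪)[c]` is finite when `𝒪/c𝒪` is (`c ≠ 0` in `F`);
* `exists_cofree_coordinates_triangular` — the triangular form along a map `φ : H → G` killing the lower-left entries.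

References: [Greenberg1989] §1 p. 98 (1)–(4); [EmertonPollackWeston2006] §3.1, (eq:ordes) and the sequence `0 → A'_f → A_f → A''_f → 0`.
-/

noncomputable section

open scoped Classical
open Matrix Literature.NumberTheory.GaloisRepresentations
open scoped MatrixGroups

namespace Literature.NumberTheory.EllipticCurves.GreenbergSelmer

variable {G : Type*} [Group G] [TopologicalSpace G] {𝒪 : Type*} [CommRing 𝒪] [TopologicalSpace 𝒪]
  {F : Type*} [Field F] [Algebra 𝒪 F]

omit [TopologicalSpace 𝒪] in
/-- `𝒪`-scalars pass through `mulVec` over `F`. [folklore] -/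
private theorem mulVec_smul_algebraMap (M : Matrix (Fin 2) (Fin 2) F) (t : 𝒪) (v : Fin 2 → F) :
    M *ᵥ (t • v) = t • (M *ᵥ v) := by
  rw [← algebraMap_smul F t v, Matrix.mulVec_smul, algebraMap_smul]

omit [TopologicalSpace 𝒪] in
/-- A vector with coordinates in `𝒪` (i.e. in the lattice) stays in the lattice under an integral matrix. [cite: Greenberg1989, §1 p. 98] -/
private theorem map_mulVec_mem_lattice (N : Matrix (Fin 2) (Fin 2) 𝒪) {v : Fin 2 → F} (hv : v ∈ lattice 2 𝒪 F) :
    (N.map (algebraMap 𝒪 F)) *ᵥ v ∈ lattice 2 𝒪 F := by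
  obtain ⟨y, rfl⟩ := (mem_lattice_iff v).1 hv
  refine (mem_lattice_iff _).2 ⟨N *ᵥ y, ?_⟩
  funext i
  exact RingHom.map_mulVec (algebraMap 𝒪 F) N y i

/-- **Coordinates on `A = F²/𝒪²` in a frame `Q₀ ∈ GL₂(𝒪)`.** There is an `𝒪`-linear isomorphism
`Φ : Cofree ρ F ≃ (F ⧸ 𝒪) × (F ⧸ 𝒪)` (`v mod 𝒪² ↦` the two coordinates of `Q₀⁻¹v` modulo `𝒪 = range (𝒪 → F)`) such that for
every `g ∈ G`, writing `T = Q₀⁻¹ ρ(g) Q₀ ∈ GL₂(𝒪)` and `Φ(a) = (y₀, y₁)`: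
`Φ(g · a) = (T₀₀ • y₀ + T₀₁ • y₁, T₁₀ • y₀ + T₁₁ • y₁)`. (For an ordinary frame `T₁₀ = 0`: the exact sequence
`0 → A' → A → A'' → 0` of EPW §3.1 in coordinates.) [cite: EmertonPollackWeston2006, §3.1 ((eq:ordes) and the sequence 0 → A'_f → A_f → A''_f → 0)]
[cite: Greenberg1989, §1 p. 98 (1)–(4)] -/
theorem exists_cofree_coordinates (ρ : FramedRep G 𝒪 2) (Q₀ : GL (Fin 2) 𝒪) :
    ∃ Φ : Cofree ρ F ≃ₗ[𝒪]
        (F ⧸ LinearMap.range (Algebra.linearMap 𝒪 F)) × (F ⧸ LinearMap.range (Algebra.linearMap 𝒪 F)),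
      ∀ (g : G) (a : Cofree ρ F),
        Φ (cofreeRepresentation F ρ g a) =
          ((((Q₀⁻¹ * ρ g * Q₀ : GL (Fin 2) 𝒪) : Matrix (Fin 2) (Fin 2) 𝒪) 0 0) • (Φ a).1 +
              (((Q₀⁻¹ * ρ g * Q₀ : GL (Fin 2) 𝒪) : Matrix (Fin 2) (Fin 2) 𝒪) 0 1) • (Φ a).2,
            (((Q₀⁻¹ * ρ g * Q₀ : GL (Fin 2) 𝒪) : Matrix (Fin 2) (Fin 2) 𝒪) 1 0) • (Φ a).1 +
              (((Q₀⁻¹ * ρ g * Q₀ : GL (Fin 2) 𝒪) : Matrix (Fin 2) (Fin 2) 𝒪) 1 1) • (Φ a).2) := by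
  -- notation: the order `𝒪 ⊆ F`, the frame matrices over `F`
  set 𝒪F : Submodule 𝒪 F := LinearMap.range (Algebra.linearMap 𝒪 F) with h𝒪F
  have hmem𝒪F : ∀ z : F, z ∈ 𝒪F ↔ ∃ t : 𝒪, algebraMap 𝒪 F t = z := fun z ↦ LinearMap.mem_range
  let P : Matrix (Fin 2) (Fin 2) F := ((Q₀ : GL (Fin 2) 𝒪) : Matrix (Fin 2) (Fin 2) 𝒪).map (algebraMap 𝒪 F)
  let Pinv : Matrix (Fin 2) (Fin 2) F := ((Q₀⁻¹ : GL (Fin 2) 𝒪) : Matrix (Fin 2) (Fin 2) 𝒪).map (algebraMap 𝒪 F)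
  have hPiP : Pinv * P = 1 := by
    change ((Q₀⁻¹ : GL (Fin 2) 𝒪) : Matrix (Fin 2) (Fin 2) 𝒪).map (algebraMap 𝒪 F) *
      ((Q₀ : GL (Fin 2) 𝒪) : Matrix (Fin 2) (Fin 2) 𝒪).map (algebraMap 𝒪 F) = 1
    rw [← Matrix.map_mul, Units.inv_mul, Matrix.map_one _ (map_zero _) (map_one _)]
  have hPPi : P * Pinv = 1 := by
    change ((Q₀ : GL (Fin 2) 𝒪) : Matrix (Fin 2) (Fin 2) 𝒪).map (algebraMap 𝒪 F) *
      ((Q₀⁻¹ : GL (Fin 2) 𝒪) : Matrix (Fin 2) (Fin 2) 𝒪).map (algebraMap 𝒪 F) = 1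
    rw [← Matrix.map_mul, Units.mul_inv, Matrix.map_one _ (map_zero _) (map_one _)]
  -- the coordinate map `ψ : F² → (F/𝒪)²`, `v ↦ (Q₀⁻¹v)₀, (Q₀⁻¹v)₁ mod 𝒪`
  let ψ : (Fin 2 → F) →ₗ[𝒪] (F ⧸ 𝒪F) × (F ⧸ 𝒪F) :=
    { toFun := fun v ↦ (𝒪F.mkQ ((Pinv *ᵥ v) 0), 𝒪F.mkQ ((Pinv *ᵥ v) 1))
      map_add' := fun v w ↦ by
        simp only [Matrix.mulVec_add, Pi.add_apply, map_add, Prod.mk_add_mk]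
      map_smul' := fun t v ↦ by
        simp only [mulVec_smul_algebraMap, Pi.smul_apply, map_smul, RingHom.id_apply, Prod.smul_mk] }
  have hψ : ∀ v, ψ v = (𝒪F.mkQ ((Pinv *ᵥ v) 0), 𝒪F.mkQ ((Pinv *ᵥ v) 1)) := fun v ↦ rfl
  -- `ker ψ = 𝒪²`
  have hker : ∀ v, ψ v = 0 ↔ v ∈ lattice 2 𝒪 F := by
    intro v
    rw [hψ, Prod.mk_eq_zero, Submodule.mkQ_apply, Submodule.mkQ_apply, Submodule.Quotient.mk_eq_zero,
      Submodule.Quotient.mk_eq_zero]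
    constructor
    · rintro ⟨h0, h1⟩
      -- `Q₀⁻¹ v ∈ 𝒪²`, hence `v = Q₀ (Q₀⁻¹ v) ∈ 𝒪²`
      have hw : Pinv *ᵥ v ∈ lattice 2 𝒪 F := by
        obtain ⟨t0, ht0⟩ := (hmem𝒪F _).1 h0
        obtain ⟨t1, ht1⟩ := (hmem𝒪F _).1 h1
        refine (mem_lattice_iff _).2 ⟨![t0, t1], ?_⟩
        funext i
        fin_cases i
        · exact ht0
        · exact ht1
      have hv : v = P *ᵥ (Pinv *ᵥ v) := by rw [Matrix.mulVec_mulVec, hPPi, Matrix.one_mulVec]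
      rw [hv]
      exact map_mulVec_mem_lattice _ hw
    · intro hv
      have hw := map_mulVec_mem_lattice ((Q₀⁻¹ : GL (Fin 2) 𝒪) : Matrix (Fin 2) (Fin 2) 𝒪) hv
      obtain ⟨y, hy⟩ := (mem_lattice_iff _).1 hw
      change (fun i ↦ algebraMap 𝒪 F (y i)) = Pinv *ᵥ v at hy
      refine ⟨(hmem𝒪F _).2 ⟨y 0, ?_⟩, (hmem𝒪F _).2 ⟨y 1, ?_⟩⟩
      · exact congrFun hy 0
      · exact congrFun hy 1
  -- `ψ` is onto
  have hsurj : Function.Surjective ψ := by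
    rintro ⟨b0, b1⟩
    obtain ⟨z0, rfl⟩ := Submodule.mkQ_surjective 𝒪F b0
    obtain ⟨z1, rfl⟩ := Submodule.mkQ_surjective 𝒪F b1
    refine ⟨P *ᵥ ![z0, z1], ?_⟩
    rw [hψ, Matrix.mulVec_mulVec, hPiP, Matrix.one_mulVec]
    rfl
  -- descend to `Φ : A ≃ (F/𝒪)²`
  have hle : lattice 2 𝒪 F ≤ LinearMap.ker ψ := fun v hv ↦ (hker v).2 hv
  let Φ₀ : Cofree ρ F →ₗ[𝒪] (F ⧸ 𝒪F) × (F ⧸ 𝒪F) := (lattice 2 𝒪 F).liftQ ψ hle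
  have hΦ₀ : ∀ v : Fin 2 → F, Φ₀ (cofreeMk F ρ v) = ψ v := fun v ↦ Submodule.liftQ_apply _ _ _
  have hinj : Function.Injective Φ₀ := by
    rw [injective_iff_map_eq_zero]
    intro a ha
    obtain ⟨v, rfl⟩ := cofreeMk_surjective F ρ a
    rw [hΦ₀] at ha
    exact (Submodule.Quotient.mk_eq_zero _).2 ((hker v).1 ha)
  have hsurj₀ : Function.Surjective Φ₀ := fun b ↦ by
    obtain ⟨v, hv⟩ := hsurj b
    exact ⟨cofreeMk F ρ v, by rw [hΦ₀, hv]⟩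
  refine ⟨LinearEquiv.ofBijective Φ₀ ⟨hinj, hsurj₀⟩, fun g a ↦ ?_⟩
  obtain ⟨x, rfl⟩ := cofreeMk_surjective F ρ a
  set T : Matrix (Fin 2) (Fin 2) 𝒪 := ((Q₀⁻¹ * ρ g * Q₀ : GL (Fin 2) 𝒪) : Matrix (Fin 2) (Fin 2) 𝒪) with hT
  set M : Matrix (Fin 2) (Fin 2) F := (((ρ g : GL (Fin 2) 𝒪) : Matrix (Fin 2) (Fin 2) 𝒪).map (algebraMap 𝒪 F)) with hM
  -- both sides are the class of `w = Q₀⁻¹ ρ(g) x`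
  have hTF : T.map (algebraMap 𝒪 F) = Pinv * M * P := by
    rw [hT, Units.val_mul, Units.val_mul, Matrix.map_mul, Matrix.map_mul]
  have key : T.map (algebraMap 𝒪 F) *ᵥ (Pinv *ᵥ x) = Pinv *ᵥ (M *ᵥ x) := by
    rw [hTF, Matrix.mulVec_mulVec, Matrix.mul_assoc, Matrix.mul_assoc, hPPi, Matrix.mul_one, ← Matrix.mulVec_mulVec]
  have hcoord : ∀ i : Fin 2, (T.map (algebraMap 𝒪 F) *ᵥ (Pinv *ᵥ x)) i =
      algebraMap 𝒪 F (T i 0) * (Pinv *ᵥ x) 0 + algebraMap 𝒪 F (T i 1) * (Pinv *ᵥ x) 1 := by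
    intro i
    rw [Matrix.mulVec, dotProduct, Fin.sum_univ_two, Matrix.map_apply, Matrix.map_apply]
  rw [LinearEquiv.ofBijective_apply, LinearEquiv.ofBijective_apply, cofreeRepresentation_cofreeMk,
    fracRepresentation_apply_apply, hΦ₀, hΦ₀, hψ, hψ]
  simp only
  rw [← hM, ← key]
  refine Prod.ext ?_ ?_
  · change 𝒪F.mkQ ((T.map (algebraMap 𝒪 F) *ᵥ (Pinv *ᵥ x)) 0) =
      T 0 0 • 𝒪F.mkQ ((Pinv *ᵥ x) 0) + T 0 1 • 𝒪F.mkQ ((Pinv *ᵥ x) 1)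
    rw [hcoord, map_add, ← map_smul, ← map_smul, Algebra.smul_def, Algebra.smul_def]
  · change 𝒪F.mkQ ((T.map (algebraMap 𝒪 F) *ᵥ (Pinv *ᵥ x)) 1) =
      T 1 0 • 𝒪F.mkQ ((Pinv *ᵥ x) 0) + T 1 1 • 𝒪F.mkQ ((Pinv *ᵥ x) 1)
    rw [hcoord, map_add, ← map_smul, ← map_smul, Algebra.smul_def, Algebra.smul_def]

omit [TopologicalSpace 𝒪] in
/-- **`(F/𝒪)[c]` is finite when `𝒪/c𝒪` is** (`c ∈ 𝒪` non-zero in `F`): a class `z mod 𝒪` with `c z ∈ 𝒪`, say `c z = w`, is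
`c⁻¹w mod 𝒪`, which depends only on `w mod c` ("`A_p[m] ≃ (ℤ/m)^d`" in rank one; the input `B[δ(σ₁) − 1]` finite of
`ErratumRoadFiveFixedPartTriangularReduction`). [cite: Greenberg1989, §1 p. 98] -/
theorem finite_setOf_smul_quotient_eq_zero (c : 𝒪) (hc : algebraMap 𝒪 F c ≠ 0) [Finite (𝒪 ⧸ Ideal.span {c})] :
    {y : F ⧸ LinearMap.range (Algebra.linearMap 𝒪 F) | c • y = 0}.Finite := by
  set 𝒪F : Submodule 𝒪 F := LinearMap.range (Algebra.linearMap 𝒪 F) with h𝒪F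
  have hmem𝒪F : ∀ z : F, z ∈ 𝒪F ↔ ∃ t : 𝒪, algebraMap 𝒪 F t = z := fun z ↦ LinearMap.mem_range
  -- `g w = c⁻¹ w mod 𝒪`, an `𝒪`-linear map killing `c𝒪`
  let g : 𝒪 →ₗ[𝒪] F ⧸ 𝒪F :=
    { toFun := fun w ↦ 𝒪F.mkQ ((algebraMap 𝒪 F c)⁻¹ * algebraMap 𝒪 F w)
      map_add' := fun w w' ↦ by rw [map_add, mul_add, map_add]
      map_smul' := fun t w ↦ by
        rw [RingHom.id_apply, ← map_smul, smul_eq_mul, (algebraMap 𝒪 F).map_mul, Algebra.smul_def, mul_left_comm] }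
  have hg : ∀ w, g w = 𝒪F.mkQ ((algebraMap 𝒪 F c)⁻¹ * algebraMap 𝒪 F w) := fun w ↦ rfl
  have hle : (Ideal.span {c} : Ideal 𝒪) ≤ LinearMap.ker g := by
    intro w hw
    obtain ⟨d, rfl⟩ := Ideal.mem_span_singleton'.1 hw
    rw [LinearMap.mem_ker, hg, (algebraMap 𝒪 F).map_mul, mul_comm (algebraMap 𝒪 F d), ← mul_assoc, inv_mul_cancel₀ hc,
      one_mul, Submodule.mkQ_apply, Submodule.Quotient.mk_eq_zero]
    exact (hmem𝒪F _).2 ⟨d, rfl⟩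
  let gq : (𝒪 ⧸ Ideal.span {c}) →ₗ[𝒪] F ⧸ 𝒪F := (Ideal.span {c}).liftQ g hle
  refine (Set.finite_range gq).subset fun y hy ↦ ?_
  obtain ⟨z, rfl⟩ := Submodule.mkQ_surjective 𝒪F y
  have hcz : c • z ∈ 𝒪F := by
    rw [Set.mem_setOf_eq, ← map_smul, Submodule.mkQ_apply, Submodule.Quotient.mk_eq_zero] at hy
    exact hy
  obtain ⟨w, hw⟩ := (hmem𝒪F _).1 hcz
  refine ⟨Ideal.Quotient.mk _ w, ?_⟩
  change gq (Submodule.Quotient.mk w) = 𝒪F.mkQ z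
  rw [Submodule.liftQ_apply, hg, hw, Algebra.smul_def, ← mul_assoc, inv_mul_cancel₀ hc, one_mul]

/-- **Triangular form of the coordinates.** If, along a map `φ : H → G`, every `Q₀⁻¹ρ(φ σ)Q₀` has vanishing lower-left entry,
the coordinates `Φ` of `exists_cofree_coordinates` exhibit the action of `H` on `A ≅ (F/𝒪) × (F/𝒪)` in TRIANGULAR form
`Φ(σ·a) = (T₀₀ y₀ + T₀₁ y₁, T₁₁ y₁)` — the shape `0 → A' → A → A'' → 0` of EPW §3.1 (eq:ordes) for an ordinary frame.
[cite: EmertonPollackWeston2006, §3.1 ((eq:ordes) and the sequence 0 → A'_f → A_f → A''_f → 0)] [cite: Greenberg1989, §1 p. 98 (1)–(4)] -/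
theorem exists_cofree_coordinates_triangular (ρ : FramedRep G 𝒪 2) (Q₀ : GL (Fin 2) 𝒪) {H : Type*} (φ : H → G)
    (h10 : ∀ σ : H, (((Q₀⁻¹ * ρ (φ σ) * Q₀ : GL (Fin 2) 𝒪) : Matrix (Fin 2) (Fin 2) 𝒪) 1 0) = 0) :
    ∃ Φ : Cofree ρ F ≃ₗ[𝒪]
        (F ⧸ LinearMap.range (Algebra.linearMap 𝒪 F)) × (F ⧸ LinearMap.range (Algebra.linearMap 𝒪 F)),
      ∀ (σ : H) (a : Cofree ρ F),
        Φ (cofreeRepresentation F ρ (φ σ) a) =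
          ((((Q₀⁻¹ * ρ (φ σ) * Q₀ : GL (Fin 2) 𝒪) : Matrix (Fin 2) (Fin 2) 𝒪) 0 0) • (Φ a).1 +
              (((Q₀⁻¹ * ρ (φ σ) * Q₀ : GL (Fin 2) 𝒪) : Matrix (Fin 2) (Fin 2) 𝒪) 0 1) • (Φ a).2,
            (((Q₀⁻¹ * ρ (φ σ) * Q₀ : GL (Fin 2) 𝒪) : Matrix (Fin 2) (Fin 2) 𝒪) 1 1) • (Φ a).2) := by
  obtain ⟨Φ, hΦ⟩ := exists_cofree_coordinates (F := F) ρ Q₀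
  refine ⟨Φ, fun σ a ↦ ?_⟩
  rw [hΦ (φ σ) a, h10 σ, zero_smul, zero_add]

end Literature.NumberTheory.EllipticCurves.GreenbergSelmer

end
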